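import Mathlib

/-!
# K2 first rung (route `SignSymmetricPowers`, item stmt-HodgeConjecture-19717) — the degree-2 core

Helper file for crux `PowersHodgeOfSignCommutators` (rank 3) of route
`route-HodgeConjecture-SignSymmetricPowers`; to be landed by a prover as
`Summits/HodgeConjecture/HodgeConjecture/Theorems/SignCommutatorDegreeTwoCore.lean`
with `--supports stmt-HodgeConjecture-19717` (it does not close the item; it is the BC5 / T3
witness rung `SignCommutatorDegreeTwoCore` of the route filing, `stub_square`'s `k ≤ 1` core in the
registered skeleton 58fb38b5).  Sorry-free; axioms `propext`, `Classical.choice`, `Quot.sound`.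

Pure linear algebra over a field `K` (`CharZero K` where a `2` or a `3` is inverted; the route needs
`K = ℚ`).  Data: a non-degenerate alternating bilinear form `Q` on `V`, an isometric involution `s`
(`s ^ 2 = 1`, `Q (s x) (s y) = Q x y`; eigenspaces `M₊ = ker (s - 1)`, `M₋ = ker (s + 1)`).
The *sign centraliser* is the group of `Q`-isometries `g : V ≃ₗ[K] V` commuting with `s`
(abstractly `Sp(M₊) × Sp(M₋)`); its two clauses are written out verbatim — they are the clauses of
`Cen` in the route file `Theses/SignSymmetricPowers.lean`.

## Main results

* `exists_signCentraliser_commutator_eq_transvection` — every symplectic transvection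
  `x ↦ x + (a * Q x v) • v` along an EIGENVECTOR `v` of `s` is a commutator `g * h * g⁻¹ * h⁻¹` of
  two elements of the sign centraliser.  Explicitly `g` = the hyperbolic dilation (`v ↦ 2 v`,
  `w ↦ w / 2` on a hyperbolic pair `(v, w)`, `Q v w = 1`, inside the SAME eigenspace, identity on
  `⟨v, w⟩^⊥`), `h` = the transvection with parameter `a / 3`; the conjugation relation
  `g ∘ T_{v,b} = T_{v,4b} ∘ g` (`dilation_transvection`) gives `[g, T_{v,b}] = T_{v,3b}`.
  This is the piece of «`Sp(M₊) × Sp(M₋)` is perfect» that the crux consumes: its hypothesis puts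
  only COMMUTATORS of the sign centraliser into the Hodge group.
* `signCommutator_invariant_bilinForm_eq` (= rung `SignCommutatorDegreeTwoCore`) — a bilinear form
  `c` on `V` invariant under every such commutator is `α • B₊ + β • B₋` with
  `B_± (x, y) = Q (x, y ± s y)` (the two eigen-pairings): the degree-2 instance of the first
  fundamental theorem for `Sp(M₊) × Sp(M₋)`, reached from COMMUTATOR invariance only.  (All
  degrees, in matrix form and from FULL-centraliser invariance:
  `Literature.RepresentationTheory.ClassicalInvariants.mem_span_taggedContraction_of_forall_commute_signInvolution`.)

## Proof

(1) `Q (s x) u = ε Q x u` for an `ε`-eigenvector `u` (`apply_isometry_eigenvector`); in particular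
`M₊ ⊥ M₋`.  (2) Transvections `T x = x + (b * Q x v) • v` and hyperbolic dilations
`D x = x + (α * Q x w) • v + (β * Q x v) • w` along eigenvectors (handled through their pointwise
formulas; no auxiliary definitions) are `Q`-isometries commuting with `s` (`transvection_isometry`,
`transvection_comm`, `dilation_isometry`, `dilation_comm`), invertible (`exists_transvection_equiv`,
`exists_dilation_equiv`: `LinearEquiv.ofLinear` with explicit inverses), and satisfy the conjugation
relation above (`dilation_transvection`); a hyperbolic partner inside the eigenspace exists by non-degeneracy
(`exists_hyperbolic_partner`: project a `w₀` with `Q v w₀ ≠ 0` to the eigenspace, which doubles the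
pairing, and rescale).  (3) Invariance of `c` under `T_{u,1}` and `T_{u,-1}` gives
`Q y u · c x u + Q x u · c u y = 0`, whence `c (·, u) = μ_u Q (·, u)` and `c (u, ·) = -μ_u Q (·, u)`
(`exists_dual_vector`).  (4) `μ` is constant on each eigenspace: for eigenvectors `v₀ ≠ 0`, `u` the
same identity for `v₀ + u` yields `(μ_{v₀} - μ_u)(Q x v₀ Q y u - Q x u Q y v₀) = 0`; if the
multipliers differ, `Q (·, u)` is proportional to `Q (·, v₀)`, so `u ∈ K v₀` by non-degeneracy and
the claim holds anyway.  (5) Assemble on `2 y = (y + s y) + (y - s y)`.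

Planner P3 g15 (hodge-nonav), 2026-08-27.  No new axioms, no sorries, `import Mathlib` only.
-/

namespace Summit.HodgeConjecture.HodgeConjecture.Theorems.SignCommutatorDegreeTwoCore

open LinearMap

variable {K V : Type*} [Field K] [AddCommGroup V] [Module K V] {Q : LinearMap.BilinForm K V}

/-- `Q (s x) u = ε * Q x u` for an `ε`-eigenvector `u` of the `Q`-isometry `s`, `ε² = 1`. -/
theorem apply_isometry_eigenvector {s : V →ₗ[K] V} (hsQ : ∀ x y, Q (s x) (s y) = Q x y)
    {u : V} {ε : K} (hε : ε * ε = 1) (hu : s u = ε • u) (x : V) : Q (s x) u = ε * Q x u := by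
  have h1 : Q (s x) (s u) = Q x u := hsQ x u
  rw [hu, map_smul, smul_eq_mul] at h1
  calc Q (s x) u = ε * ε * Q (s x) u := by rw [hε, one_mul]
    _ = ε * Q x u := by rw [mul_assoc, h1]

/-! ### Symplectic transvections `T x = x + (b * Q x v) • v` (given by their pointwise formula) -/

/-- Transvections along a fixed `v` compose additively in the parameter (`Q v v = 0`). -/
theorem transvection_comp (hQa : Q.IsAlt) {v : V} {b b' : K} {T T' : V → V}
    (hT : ∀ x, T x = x + (b * Q x v) • v) (hT' : ∀ x, T' x = x + (b' * Q x v) • v) (x : V) :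
    T (T' x) = x + ((b + b') * Q x v) • v := by
  simp only [hT, hT', map_add, map_smul, LinearMap.add_apply, LinearMap.smul_apply, smul_eq_mul,
    hQa.self_eq_zero v, mul_zero]
  module

/-- Transvections are `Q`-isometries (`Q` alternating). -/
theorem transvection_isometry (hQa : Q.IsAlt) {v : V} {b : K} {T : V → V}
    (hT : ∀ x, T x = x + (b * Q x v) • v) (x y : V) : Q (T x) (T y) = Q x y := by
  have hvy : Q v y = -Q y v := (hQa.neg_eq y v).symm
  simp only [hT, map_add, map_smul, LinearMap.add_apply, LinearMap.smul_apply, smul_eq_mul,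
    hQa.self_eq_zero v, hvy]
  ring

/-- A transvection along an `ε`-eigenvector of `s` commutes with `s`. -/
theorem transvection_comm {s : V →ₗ[K] V} (hsQ : ∀ x y, Q (s x) (s y) = Q x y)
    {v : V} {ε : K} (hε : ε * ε = 1) (hv : s v = ε • v) {b : K} {T : V → V}
    (hT : ∀ x, T x = x + (b * Q x v) • v) (x : V) : T (s x) = s (T x) := by
  simp only [hT, map_add, map_smul, hv, apply_isometry_eigenvector hsQ hε hv, smul_smul]
  ring_nf

/-- The transvection `x ↦ x + (b * Q x v) • v` as a linear automorphism (inverse parameter `-b`). -/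
theorem exists_transvection_equiv (hQa : Q.IsAlt) (v : V) (b : K) :
    ∃ T : V ≃ₗ[K] V, ∀ x, T x = x + (b * Q x v) • v := by
  have happ : ∀ (b : K) (x : V),
      (LinearMap.id + (b • Q.flip v).smulRight v : V →ₗ[K] V) x = x + (b * Q x v) • v := by
    intro b x
    simp
  refine ⟨LinearEquiv.ofLinear (LinearMap.id + (b • Q.flip v).smulRight v)
      (LinearMap.id + ((-b) • Q.flip v).smulRight v) ?_ ?_, happ b⟩
  · ext x
    rw [LinearMap.comp_apply, transvection_comp hQa (happ b) (happ (-b)), LinearMap.id_apply]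
    simp
  · ext x
    rw [LinearMap.comp_apply, transvection_comp hQa (happ (-b)) (happ b), LinearMap.id_apply]
    simp

/-! ### Hyperbolic dilations `D x = x + (α * Q x w) • v + (β * Q x v) • w` on a pair `Q v w = 1` -/

/-- Two dilations on the same hyperbolic pair compose to the identity when
`α' + α + α α' = 0` and `β' + β - β β' = 0`. -/
theorem dilation_comp (hQa : Q.IsAlt) {v w : V} (hvw : Q v w = 1) {α β α' β' : K}
    (hα : α' + α + α * α' = 0) (hβ : β' + β - β * β' = 0) {D D' : V → V}
    (hD : ∀ x, D x = x + (α * Q x w) • v + (β * Q x v) • w)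
    (hD' : ∀ x, D' x = x + (α' * Q x w) • v + (β' * Q x v) • w) (x : V) : D (D' x) = x := by
  have hwv : Q w v = -1 := by rw [← hvw]; exact (hQa.neg_eq v w).symm
  simp only [hD, hD', map_add, map_smul, LinearMap.add_apply, LinearMap.smul_apply, smul_eq_mul,
    hQa.self_eq_zero v, hQa.self_eq_zero w, hvw, hwv]
  have e1 : α' * Q x w + α * (Q x w + α' * Q x w * 1 + β' * Q x v * 0) = 0 := by
    linear_combination (Q x w) * hα
  have e2 : β' * Q x v + β * (Q x v + α' * Q x w * 0 + β' * Q x v * (-1)) = 0 := by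
    linear_combination (Q x v) * hβ
  linear_combination (norm := module) e1 • v + e2 • w

/-- A dilation on a hyperbolic pair is a `Q`-isometry when `α - β - α β = 0`
(i.e. `(1 + α)(1 - β) = 1`). -/
theorem dilation_isometry (hQa : Q.IsAlt) {v w : V} (hvw : Q v w = 1) {α β : K}
    (hαβ : α - β - α * β = 0) {D : V → V} (hD : ∀ x, D x = x + (α * Q x w) • v + (β * Q x v) • w)
    (x y : V) : Q (D x) (D y) = Q x y := by
  have hwv : Q w v = -1 := by rw [← hvw]; exact (hQa.neg_eq v w).symm
  have hvy : Q v y = -Q y v := (hQa.neg_eq y v).symm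
  have hwy : Q w y = -Q y w := (hQa.neg_eq y w).symm
  simp only [hD, map_add, map_smul, LinearMap.add_apply, LinearMap.smul_apply, smul_eq_mul,
    hQa.self_eq_zero v, hQa.self_eq_zero w, hvw, hwv, hvy, hwy]
  linear_combination (Q x v * Q y w - Q x w * Q y v) * hαβ

/-- A dilation on a hyperbolic pair inside the `ε`-eigenspace of `s` commutes with `s`. -/
theorem dilation_comm {s : V →ₗ[K] V} (hsQ : ∀ x y, Q (s x) (s y) = Q x y)
    {v w : V} {ε : K} (hε : ε * ε = 1) (hv : s v = ε • v) (hw : s w = ε • w) {α β : K}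
    {D : V → V} (hD : ∀ x, D x = x + (α * Q x w) • v + (β * Q x v) • w) (x : V) :
    D (s x) = s (D x) := by
  simp only [hD, map_add, map_smul, hv, hw, apply_isometry_eigenvector hsQ hε hv,
    apply_isometry_eigenvector hsQ hε hw, smul_smul]
  ring_nf

/-- Conjugation relation `D ∘ T_b = T_{b''} ∘ D` with `b'' (1 - β) = b (1 + α)`, written with the
formula for `T_{b''}`. -/
theorem dilation_transvection (hQa : Q.IsAlt) {v w : V} (hvw : Q v w = 1) {α β b b'' : K}
    (h : b'' * (1 - β) = b * (1 + α)) {D T : V → V}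
    (hD : ∀ x, D x = x + (α * Q x w) • v + (β * Q x v) • w) (hT : ∀ x, T x = x + (b * Q x v) • v)
    (y : V) : D (T y) = D y + (b'' * Q (D y) v) • v := by
  have hwv : Q w v = -1 := by rw [← hvw]; exact (hQa.neg_eq v w).symm
  simp only [hD, hT, map_add, map_smul, LinearMap.add_apply, LinearMap.smul_apply, smul_eq_mul,
    hQa.self_eq_zero v, hvw, hwv]
  linear_combination (norm := module) (-(Q y v) * h) • v

/-- The hyperbolic dilation with `λ = 2` (`α = 1`, `β = 1/2`; inverse `α' = -1/2`, `β' = -1`) as a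
linear automorphism. -/
theorem exists_dilation_equiv [CharZero K] (hQa : Q.IsAlt) {v w : V} (hvw : Q v w = 1) :
    ∃ D : V ≃ₗ[K] V, ∀ x, D x = x + (1 * Q x w) • v + (1 / 2 * Q x v) • w := by
  have happ : ∀ (α β : K) (x : V),
      (LinearMap.id + (α • Q.flip w).smulRight v + (β • Q.flip v).smulRight w : V →ₗ[K] V) x =
        x + (α * Q x w) • v + (β * Q x v) • w := by
    intro α β x
    simp
  refine ⟨LinearEquiv.ofLinear
      (LinearMap.id + ((1 : K) • Q.flip w).smulRight v + ((1 / 2 : K) • Q.flip v).smulRight w)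
      (LinearMap.id + ((-(1 / 2) : K) • Q.flip w).smulRight v + ((-1 : K) • Q.flip v).smulRight w)
      ?_ ?_, happ 1 (1 / 2)⟩
  · ext x
    rw [LinearMap.comp_apply, LinearMap.id_apply]
    exact dilation_comp hQa hvw (by norm_num) (by norm_num) (happ 1 (1 / 2))
      (happ (-(1 / 2)) (-1)) x
  · ext x
    rw [LinearMap.comp_apply, LinearMap.id_apply]
    exact dilation_comp hQa hvw (by norm_num) (by norm_num) (happ (-(1 / 2)) (-1))
      (happ 1 (1 / 2)) x

/-- Pointwise commutators: if `g (h y) = f (h (g y))` for all `y` then `g h g⁻¹ h⁻¹ = f`. -/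
theorem commutator_apply_of {g h : V ≃ₗ[K] V} {f : V → V} (H : ∀ y, g (h y) = f (h (g y)))
    (x : V) : (g * h * g⁻¹ * h⁻¹) x = f x := by
  have := H (g.symm (h.symm x))
  simpa using this

/-- In the same `ε`-eigenspace as a non-zero `v` there is a hyperbolic partner `w`. -/
theorem exists_hyperbolic_partner [CharZero K] (hQn : Q.Nondegenerate) {s : V →ₗ[K] V}
    (hs : ∀ x, s (s x) = x) (hsQ : ∀ x y, Q (s x) (s y) = Q x y) {v : V} (hv0 : v ≠ 0) {ε : K}
    (hε : ε * ε = 1) (hv : s v = ε • v) : ∃ w : V, Q v w = 1 ∧ s w = ε • w := by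
  obtain ⟨w₀, hw₀⟩ : ∃ w₀, Q v w₀ ≠ 0 := by
    by_contra! h
    exact hv0 (hQn.1 v h)
  set w₁ := w₀ + ε • s w₀ with hw₁
  have hsw₁ : s w₁ = ε • w₁ := by
    simp only [hw₁, map_add, map_smul, hs, smul_add, smul_smul, hε, one_smul]
    abel
  have hQ₁ : Q v w₁ = 2 * Q v w₀ := by
    have h2 : ε * Q v (s w₀) = Q v w₀ := by
      have := hsQ v w₀
      rwa [hv, map_smul, LinearMap.smul_apply, smul_eq_mul] at this
    simp only [hw₁, map_add, map_smul, smul_eq_mul, h2]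
    ring_nf
  have hQ₁0 : Q v w₁ ≠ 0 := by rw [hQ₁]; exact mul_ne_zero two_ne_zero hw₀
  refine ⟨(Q v w₁)⁻¹ • w₁, ?_, ?_⟩
  · rw [map_smul, smul_eq_mul, inv_mul_cancel₀ hQ₁0]
  · rw [map_smul, hsw₁, smul_comm]

/-- For `u ≠ 0` there is `y₀` with `Q y₀ u = 1` (right non-degeneracy). -/
theorem exists_dual_vector (hQn : Q.Nondegenerate) {u : V} (hu : u ≠ 0) :
    ∃ y₀ : V, Q y₀ u = 1 := by
  obtain ⟨x₁, hx₁⟩ : ∃ x₁, Q x₁ u ≠ 0 := by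
    by_contra! h
    exact hu (hQn.2 u h)
  exact ⟨(Q x₁ u)⁻¹ • x₁, by rw [map_smul, LinearMap.smul_apply, smul_eq_mul, inv_mul_cancel₀ hx₁]⟩

variable (Q)

/-- **Transvections along eigenvectors of `s` are commutators in the sign centraliser.**
For `v` with `s v = v` or `s v = -v` and any `a`, the symplectic transvection
`x ↦ x + (a * Q x v) • v` equals `g * h * g⁻¹ * h⁻¹` for `Q`-isometries `g h` commuting with `s`. -/
theorem exists_signCentraliser_commutator_eq_transvection [CharZero K]
    (hQa : Q.IsAlt) (hQn : Q.Nondegenerate)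
    (s : V →ₗ[K] V) (hs : s ^ 2 = 1) (hsQ : ∀ x y, Q (s x) (s y) = Q x y)
    {v : V} (hv : s v = v ∨ s v = -v) (a : K) :
    ∃ g h : V ≃ₗ[K] V, ((∀ x, g (s x) = s (g x)) ∧ ∀ x y, Q (g x) (g y) = Q x y) ∧
      ((∀ x, h (s x) = s (h x)) ∧ ∀ x y, Q (h x) (h y) = Q x y) ∧
      ∀ x, (g * h * g⁻¹ * h⁻¹) x = x + (a * Q x v) • v := by
  rcases eq_or_ne v 0 with rfl | hv0
  · exact ⟨1, 1, ⟨fun x => rfl, fun x y => rfl⟩, ⟨fun x => rfl, fun x y => rfl⟩, fun x => by simp⟩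
  have hss : ∀ x, s (s x) = x := fun x => by
    have := LinearMap.congr_fun hs x
    simpa [pow_two] using this
  obtain ⟨ε, hε, hvε⟩ : ∃ ε : K, ε * ε = 1 ∧ s v = ε • v := by
    rcases hv with h | h
    · exact ⟨1, one_mul 1, by rw [h, one_smul]⟩
    · exact ⟨-1, by ring, by rw [h, neg_one_smul]⟩
  obtain ⟨w, hvw, hwε⟩ := exists_hyperbolic_partner hQn hss hsQ hv0 hε hvε
  obtain ⟨D, hD⟩ := exists_dilation_equiv hQa hvw
  obtain ⟨T, hT⟩ := exists_transvection_equiv hQa v (a / 3)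
  refine ⟨D, T, ⟨fun x => dilation_comm hsQ hε hvε hwε hD x,
    fun x y => dilation_isometry hQa hvw (by norm_num) hD x y⟩,
    ⟨fun x => transvection_comm hsQ hε hvε hT x, fun x y => transvection_isometry hQa hT x y⟩, ?_⟩
  refine commutator_apply_of fun y => ?_
  show D (T y) = T (D y) + (a * Q (T (D y)) v) • v
  rw [dilation_transvection hQa hvw (b'' := a + a / 3) (by ring) hD hT, hT (D y)]
  simp only [map_add, map_smul, LinearMap.add_apply, LinearMap.smul_apply, smul_eq_mul,
    hQa.self_eq_zero v, mul_zero]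
  module

/-- **Rung `SignCommutatorDegreeTwoCore`** (degree-2 core of crux `PowersHodgeOfSignCommutators`):
a bilinear form invariant under all commutators of the sign centraliser is a combination of the two
eigen-pairings `Q (x, y + s y)` and `Q (x, y - s y)`. -/
theorem signCommutator_invariant_bilinForm_eq [CharZero K]
    (hQa : Q.IsAlt) (hQn : Q.Nondegenerate)
    (s : V →ₗ[K] V) (hs : s ^ 2 = 1) (hsQ : ∀ x y, Q (s x) (s y) = Q x y)
    (c : LinearMap.BilinForm K V)
    (hc : ∀ g h : V ≃ₗ[K] V, (∀ x, g (s x) = s (g x)) → (∀ x y, Q (g x) (g y) = Q x y) →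
      (∀ x, h (s x) = s (h x)) → (∀ x y, Q (h x) (h y) = Q x y) →
      ∀ x y, c ((g * h * g⁻¹ * h⁻¹) x) ((g * h * g⁻¹ * h⁻¹) y) = c x y) :
    ∃ α β : K, ∀ x y, c x y = α * Q x (y + s y) + β * Q x (y - s y) := by
  have hss : ∀ x, s (s x) = x := fun x => by
    have := LinearMap.congr_fun hs x
    simpa [pow_two] using this
  -- (0) invariance of `c` under every transvection along an eigenvector of `s`
  have hT : ∀ {u : V} {ε : K}, (ε = 1 ∨ ε = -1) → s u = ε • u → ∀ (a : K) (x y : V),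
      c (x + (a * Q x u) • u) (y + (a * Q y u) • u) = c x y := by
    intro u ε hε hu a x y
    have hu' : s u = u ∨ s u = -u := by
      rcases hε with rfl | rfl
      · exact Or.inl (by rw [hu, one_smul])
      · exact Or.inr (by rw [hu, neg_one_smul])
    obtain ⟨g, h, ⟨hg1, hg2⟩, ⟨hh1, hh2⟩, hgh⟩ :=
      exists_signCentraliser_commutator_eq_transvection Q hQa hQn s hs hsQ hu' a
    have := hc g h hg1 hg2 hh1 hh2 x y
    rwa [hgh x, hgh y] at this
  have expand : ∀ (a : K) (u x y : V), c (x + (a * Q x u) • u) (y + (a * Q y u) • u) =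
      c x y + a * Q y u * c x u + a * Q x u * c u y + a * Q x u * (a * Q y u) * c u u := by
    intro a u x y
    simp only [map_add, map_smul, LinearMap.add_apply, LinearMap.smul_apply, smul_eq_mul]
    ring
  -- (A) the basic identity from invariance under `T_{u,1}` and `T_{u,-1}`
  have hA : ∀ {u : V} {ε : K}, (ε = 1 ∨ ε = -1) → s u = ε • u → ∀ x y,
      Q y u * c x u + Q x u * c u y = 0 := by
    intro u ε hε hu x y
    have h1 := hT hε hu 1 x y
    have h2 := hT hε hu (-1) x y
    rw [expand] at h1 h2
    linear_combination (1 / 2 : K) * h1 - (1 / 2 : K) * h2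
  -- (C) `c (·, u)` and `c (u, ·)` are multiples of `Q (·, u)`
  have hC : ∀ {u : V} {ε : K}, (ε = 1 ∨ ε = -1) → s u = ε • u →
      ∃ μ : K, (∀ x, c x u = μ * Q x u) ∧ ∀ y, c u y = -(μ * Q y u) := by
    intro u ε hε hu
    rcases eq_or_ne u 0 with rfl | hu0
    · exact ⟨0, fun x => by simp, fun y => by simp⟩
    obtain ⟨y₀, hy₀⟩ := exists_dual_vector hQn hu0
    have hx : ∀ x, c x u = -(c u y₀) * Q x u := fun x => by
      have := hA hε hu x y₀
      rw [hy₀, one_mul] at this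
      linear_combination this
    refine ⟨-(c u y₀), hx, fun y => ?_⟩
    have h1 := hA hε hu y₀ y
    rw [hy₀, one_mul] at h1
    have h2 := hx y₀
    rw [hy₀, mul_one] at h2
    linear_combination h1 - (Q y u) * h2
  -- (D) the multiplier is constant on each eigenspace
  have hD : ∀ {ε : K}, (ε = 1 ∨ ε = -1) →
      ∃ μ : K, ∀ u, s u = ε • u → ∀ x, c x u = μ * Q x u := by
    intro ε hε
    by_cases hex : ∃ v₀, v₀ ≠ 0 ∧ s v₀ = ε • v₀
    · obtain ⟨v₀, hv₀, hsv₀⟩ := hex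
      obtain ⟨μ, hμ1, hμ2⟩ := hC hε hsv₀
      obtain ⟨y₀, hy₀⟩ := exists_dual_vector hQn hv₀
      refine ⟨μ, fun u hu x => ?_⟩
      obtain ⟨μu, hu1, hu2⟩ := hC hε hu
      have hsum : s (v₀ + u) = ε • (v₀ + u) := by rw [map_add, hsv₀, hu, smul_add]
      have key : ∀ x y, (μ - μu) * (Q x v₀ * Q y u - Q x u * Q y v₀) = 0 := fun x y => by
        have h := hA hε hsum x y
        simp only [map_add, LinearMap.add_apply, hμ1, hμ2, hu1, hu2] at h
        linear_combination h
      rcases eq_or_ne μ μu with h | hne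
      · rw [hu1, h]
      · have prop : ∀ x, Q x u = Q y₀ u * Q x v₀ := fun x => by
          have h1 := key x y₀
          rw [hy₀, mul_one] at h1
          have h2 := (mul_eq_zero.mp h1).resolve_left (sub_ne_zero.mpr hne)
          linear_combination -h2
        have hut : u = Q y₀ u • v₀ := by
          rw [← sub_eq_zero]
          refine hQn.2 _ fun x => ?_
          rw [map_sub, map_smul, smul_eq_mul, prop x, sub_self]
        calc c x u = c x (Q y₀ u • v₀) := by rw [← hut]
          _ = μ * Q x u := by rw [map_smul, smul_eq_mul, hμ1, prop x]; ring
    · refine ⟨0, fun u hu x => ?_⟩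
      have hu0 : u = 0 := by
        by_contra h
        exact hex ⟨u, h, hu⟩
      simp [hu0]
  -- (E) assemble on `y = (y + s y)/2 + (y - s y)/2`
  obtain ⟨μp, hμp⟩ := hD (ε := 1) (Or.inl rfl)
  obtain ⟨μm, hμm⟩ := hD (ε := -1) (Or.inr rfl)
  refine ⟨μp / 2, μm / 2, fun x y => ?_⟩
  have hp : s (y + s y) = (1 : K) • (y + s y) := by rw [one_smul, map_add, hss, add_comm]
  have hm : s (y - s y) = (-1 : K) • (y - s y) := by rw [map_sub, hss, neg_one_smul, neg_sub]
  have e1 := hμp _ hp x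
  have e2 := hμm _ hm x
  have h2 : c x (y + s y) + c x (y - s y) = 2 * c x y := by
    simp only [map_add, map_sub]
    ring
  linear_combination (1 / 2 : K) * e1 + (1 / 2 : K) * e2 - (1 / 2 : K) * h2

/-- Registered stub of item stmt-HodgeConjecture-19717 (rung `SignCommutatorDegreeTwoCore`, fully
quantified form of `signCommutator_invariant_bilinForm_eq`). -/
theorem stub_signCommutatorDegreeTwoCore : ∀ (K V : Type _) [Field K] [CharZero K] [AddCommGroup V] [Module K V] (Q : LinearMap.BilinForm K V), Q.IsAlt → Q.Nondegenerate → ∀ (s : V →ₗ[K] V), s ^ 2 = 1 → (∀ x y, Q (s x) (s y) = Q x y) → ∀ (c : LinearMap.BilinForm K V), (∀ g h : V ≃ₗ[K] V, (∀ x, g (s x) = s (g x)) → (∀ x y, Q (g x) (g y) = Q x y) → (∀ x, h (s x) = s (h x)) → (∀ x y, Q (h x) (h y) = Q x y) → ∀ x y, c ((g * h * g⁻¹ * h⁻¹) x) ((g * h * g⁻¹ * h⁻¹) y) = c x y) → ∃ α β : K, ∀ x y, c x y = α * Q x (y + s y) + β * Q x (y - s y) :=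
  fun _ _ _ _ _ _ Q hQa hQn s hs hsQ c hc => signCommutator_invariant_bilinForm_eq Q hQa hQn s hs hsQ c hc

end Summit.HodgeConjecture.HodgeConjecture.Theorems.SignCommutatorDegreeTwoCore
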